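import Literature.NumberTheory.ModularForms.BinaryThetaNull
import HarnessLib

/-!
# Binary theta series of weight two: the `v`-gradient of the genus-two law
# (Hecke 1926 §3; Schoeneberg 1939: theta series with a linear form)

Topic `Literature/NumberTheory/ModularForms`; namespace `Literature.NumberTheory.ModularForms.BinaryTheta`.
Everything here is PROVED (theorems only; no definition, no named fact).

Differentiating the transformation law of `BinaryThetaNull` (`exists_unit_riemannThetaChar_zero_transform`:
`ϑ[M[c]]((cτ+d)⁻¹v, (γτ)·B) = λ (cτ+d) e(πi k) e(πi ᵗvN_τv) ϑ[c](v, τ·B)` for all `v ∈ ℂ²`) at `v = 0`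
kills the quadratic exponential (its gradient vanishes at `0`) and produces one more factor
`cτ + d` from the chain rule: the GRADIENT `∇_v ϑ[c](0, τ·B)` — i.e. the theta series with the linear
form `ᵗℓ(m + c¹)` inserted, `Σ_m 2πi ᵗℓ(m+c¹) e(πi τ ᵗ(m+c¹)B(m+c¹) + 2πi ᵗ(m+c¹)c²)` — transforms
with the weight-TWO factor `λ (cτ+d)² e(πi k)`:

* `hasFDerivAt_cexp_dotProduct_mulVec_zero` — `v ↦ e(πi ᵗvNv)` has derivative `0` at `v = 0`;
* **`fderiv_riemannThetaChar_symplEmbed_smul`** — for `B` symmetric positive definite with even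
  diagonal, `det B ∣ c`, and the unit `λ_B(γ)`:
  `∇_v ϑ[M[c]](0, (γτ)·B) = λ (cτ+d)² e(πi k(M,c)) · ∇_v ϑ[c](0, τ·B)` as continuous linear maps
  `ℂ² → ℂ`;
* `hasFDerivAt_riemannThetaChar`, `fderiv_riemannThetaChar_apply` — the gradient as the series of
  termwise derivatives: `∇_v ϑ[a; b](v, Ω) ℓ = Σ_m 2πi ᵗ(m + a)ℓ · e(πi ᵗ(m+a)Ω(m+a) + 2πi ᵗ(m+a)(v+b))`
  (termwise differentiation under the Gaussian majorant of the tree's Prop. 3.3.6,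
  `norm_riemannThetaTerm_le`).

This is the classical passage from theta nulls (weight one) to the binary theta series with a
harmonic polynomial of degree one (weight two), Hecke 1926 §3 / Schoeneberg 1939 §2, for the
positive definite binary form `Q = ½B`.

## References

* E. Hecke, *Zur Theorie der elliptischen Modulfunktionen*, Math. Ann. 97 (1926), §3. [Hecke1926Modulfunktionen]
* A. N. Andrianov, V. G. Zhuravlev, *Modular Forms and Hecke Operators* (1995), Ch. 1 §3.3. [AndrianovZhuravlev2015]
* H. Lange, *Abelian Varieties over the Complex Numbers* (2023), §3.3.2 Prop. 3.3.6, §3.3.3 Thm. 3.3.9.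
  [Lange2023AbelianVarietiesComplex]
-/

noncomputable section

open Matrix Complex Filter Topology Set

open scoped MatrixGroups Real

namespace Literature.NumberTheory.ModularForms.BinaryTheta

open Literature.Analysis.SpecialFunctions
open Literature.NumberTheory.Automorphic (siegelUpperHalfSpace mem_siegelUpperHalfSpace_iff)
open Literature.NumberTheory.ModularForms.SiegelUpperHalfSpace

/-! ### The quadratic exponential has zero gradient at the origin -/

/-- `v ↦ ᵗv N v` has derivative `0` at `v = 0` (any square matrix `N`). [folklore] -/
private theorem hasFDerivAt_dotProduct_mulVec_zero {n : ℕ} (N : Matrix (Fin n) (Fin n) ℂ) :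
    HasFDerivAt (fun v : Fin n → ℂ => v ⬝ᵥ (N *ᵥ v)) (0 : (Fin n → ℂ) →L[ℂ] ℂ) 0 := by
  have hlin : ∀ i, HasFDerivAt (fun v : Fin n → ℂ => (N *ᵥ v) i)
      (∑ j, N i j • ContinuousLinearMap.proj (R := ℂ) (φ := fun _ : Fin n => ℂ) j) 0 := by
    intro i
    have := HasFDerivAt.fun_sum (u := Finset.univ)
      (A := fun j (v : Fin n → ℂ) => N i j * v j)
      (A' := fun j => N i j • ContinuousLinearMap.proj (R := ℂ) (φ := fun _ : Fin n => ℂ) j)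
      (x := (0 : Fin n → ℂ)) fun j _ =>
        ((ContinuousLinearMap.proj (R := ℂ) (φ := fun _ : Fin n => ℂ) j).hasFDerivAt.const_mul (N i j))
    simp only [Matrix.mulVec, dotProduct]
    convert this using 1
  have hprod : ∀ i, HasFDerivAt (fun v : Fin n → ℂ => v i * (N *ᵥ v) i) (0 : (Fin n → ℂ) →L[ℂ] ℂ) 0 := by
    intro i
    have h := ((ContinuousLinearMap.proj (R := ℂ) (φ := fun _ : Fin n => ℂ) i).hasFDerivAt).mul (hlin i)
    exact h.congr_fderiv (by ext1 v; simp)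
  have := HasFDerivAt.fun_sum (u := Finset.univ) (A := fun i (v : Fin n → ℂ) => v i * (N *ᵥ v) i)
    (A' := fun _ => (0 : (Fin n → ℂ) →L[ℂ] ℂ)) (x := (0 : Fin n → ℂ)) fun i _ => hprod i
  exact this.congr_fderiv (by ext1 v; simp)

/-- **`v ↦ e(πi ᵗv N v)` has zero gradient at `v = 0`.** [folklore] -/
private theorem hasFDerivAt_cexp_dotProduct_mulVec_zero {n : ℕ} (N : Matrix (Fin n) (Fin n) ℂ) :
    HasFDerivAt (fun v : Fin n → ℂ => cexp (π * I * (v ⬝ᵥ (N *ᵥ v)))) (0 : (Fin n → ℂ) →L[ℂ] ℂ) 0 := by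
  have h := ((hasFDerivAt_dotProduct_mulVec_zero N).const_mul (π * I)).cexp
  exact h.congr_fderiv (by ext1 v; simp)

/-! ### From a transformation law in `v` to the law for the gradient at `v = 0` -/

/-- **Differentiating a theta transformation law at `v = 0`.**  If `θ₂(w⁻¹ v) = K · e(πi ᵗvNv) · θ₁(v)`
for all `v ∈ ℂⁿ` (`w ≠ 0`), with `θ₁, θ₂` differentiable at `0`, then
`∇θ₂(0) = (w K) · ∇θ₁(0)`: the quadratic exponential has zero gradient at the origin and the inner
map `v ↦ w⁻¹v` contributes `w⁻¹` (Hecke 1926 §3: the passage from theta nulls to theta series with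
a linear form). [cite: Hecke1926Modulfunktionen, §3] -/
theorem fderiv_eq_smul_of_transform_law {n : ℕ} {θ₁ θ₂ : (Fin n → ℂ) → ℂ}
    (h₁ : DifferentiableAt ℂ θ₁ 0) (h₂ : DifferentiableAt ℂ θ₂ 0) {w K : ℂ} (hw : w ≠ 0)
    (N : Matrix (Fin n) (Fin n) ℂ)
    (hlaw : ∀ v : Fin n → ℂ, θ₂ (w⁻¹ • v) = K * cexp (π * I * (v ⬝ᵥ (N *ᵥ v))) * θ₁ v) :
    fderiv ℂ θ₂ 0 = (w * K) • fderiv ℂ θ₁ 0 := by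
  have hfun : (fun v : Fin n → ℂ => θ₂ (w⁻¹ • v)) =
      fun v => (K * cexp (π * I * (v ⬝ᵥ (N *ᵥ v)))) * θ₁ v := by
    funext v; rw [hlaw v]
  -- derivative of the left side: chain rule with `v ↦ w⁻¹ v`
  have hL : HasFDerivAt (fun v : Fin n → ℂ => θ₂ (w⁻¹ • v))
      ((fderiv ℂ θ₂ 0).comp (w⁻¹ • ContinuousLinearMap.id ℂ (Fin n → ℂ))) 0 := by
    have h1 : HasFDerivAt (fun v : Fin n → ℂ => w⁻¹ • v) (w⁻¹ • ContinuousLinearMap.id ℂ (Fin n → ℂ)) 0 :=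
      (ContinuousLinearMap.id ℂ (Fin n → ℂ)).hasFDerivAt.const_smul w⁻¹
    have h2 : HasFDerivAt θ₂ (fderiv ℂ θ₂ 0) (w⁻¹ • (0 : Fin n → ℂ)) := by
      rw [smul_zero]; exact h₂.hasFDerivAt
    exact h2.comp 0 h1
  -- derivative of the right side: product rule, the exponential contributes nothing at `0`
  have hR : HasFDerivAt (fun v : Fin n → ℂ => (K * cexp (π * I * (v ⬝ᵥ (N *ᵥ v)))) * θ₁ v)
      (K • fderiv ℂ θ₁ 0) 0 := by
    have h1 : HasFDerivAt (fun v : Fin n → ℂ => K * cexp (π * I * (v ⬝ᵥ (N *ᵥ v))))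
        (0 : (Fin n → ℂ) →L[ℂ] ℂ) 0 :=
      ((hasFDerivAt_cexp_dotProduct_mulVec_zero N).const_mul K).congr_fderiv (by ext1 v; simp)
    exact (h1.mul h₁.hasFDerivAt).congr_fderiv (by ext1 v; simp)
  rw [hfun] at hL
  have heq := hL.unique hR
  have hcomp : (fderiv ℂ θ₂ 0).comp (w⁻¹ • ContinuousLinearMap.id ℂ (Fin n → ℂ)) = w⁻¹ • fderiv ℂ θ₂ 0 := by
    rw [ContinuousLinearMap.comp_smul, ContinuousLinearMap.comp_id]
  rw [hcomp] at heq
  rw [← smul_smul, ← heq, smul_smul, mul_inv_cancel₀ hw, one_smul]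

/-! ### The weight-two law for the gradient -/

variable {B : Matrix (Fin 2) (Fin 2) ℤ} {γ : SL(2, ℤ)}

/-- **Weight-two transformation law of the gradient of binary theta series.**  Let `B` be symmetric
positive definite with even diagonal, `γ = (a' b'; c d) ∈ SL₂(ℤ)` with `det B ∣ c`, `M = symplEmbed B γ`,
and let `Λ` be a unit with the characteristic-`(a, b)` law of `exists_unit_riemannThetaChar_zero_transform`
(all `τ`, `v`).  Then for every `τ ∈ ℍ`:
`∇_v ϑ[M[c]¹; M[c]²](·, (γτ)·B)(0) = Λ (cτ+d)² e(πi k(M, a, b)) · ∇_v ϑ[a; b](·, τ·B)(0)`.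
Proof: differentiate the law at `v = 0`; `v ↦ e(πi ᵗvN_τv)` has gradient `0` there, and the inner
map `v ↦ (cτ+d)⁻¹v` contributes `(cτ+d)⁻¹` on the left. [cite: Hecke1926Modulfunktionen, §3]
[cite: AndrianovZhuravlev2015, Ch. 1 §3.3 Thm. 3.13] -/
theorem fderiv_riemannThetaChar_symplEmbed_smul (hB : B.IsSymm)
    (hpos : (B.map (Int.cast : ℤ → ℝ)).PosDef) (hγ : B.det ∣ (γ 1 0 : ℤ)) (a b : Fin 2 → ℂ) {Λ : ℂ}
    (hΛ : ∀ τ : ℂ, 0 < τ.im → ∀ v : Fin 2 → ℂ,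
      riemannThetaChar (thetaCharFst (symplEmbed B γ) a b) (thetaCharSnd (symplEmbed B γ) a b)
          (((((γ 0 0 : ℤ) : ℂ) * τ + ((γ 0 1 : ℤ) : ℂ)) / (((γ 1 0 : ℤ) : ℂ) * τ + ((γ 1 1 : ℤ) : ℂ))) •
            B.map ((↑) : ℤ → ℂ))
          ((((γ 1 0 : ℤ) : ℂ) * τ + ((γ 1 1 : ℤ) : ℂ))⁻¹ • v) =
        Λ * (((γ 1 0 : ℤ) : ℂ) * τ + ((γ 1 1 : ℤ) : ℂ)) *
          cexp (π * I * thetaTransformPhase (symplEmbed B γ) a b) *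
          cexp (π * I * (v ⬝ᵥ ((denom ((symplEmbed B γ).map ((↑) : ℤ → ℂ)) (τ • B.map ((↑) : ℤ → ℂ)))⁻¹ *
                ((symplEmbed B γ).map ((↑) : ℤ → ℂ)).toBlocks₂₁) *ᵥ v)) *
            riemannThetaChar a b (τ • B.map ((↑) : ℤ → ℂ)) v)
    {τ : ℂ} (hτ : 0 < τ.im) :
    fderiv ℂ (riemannThetaChar (thetaCharFst (symplEmbed B γ) a b) (thetaCharSnd (symplEmbed B γ) a b)
        (((((γ 0 0 : ℤ) : ℂ) * τ + ((γ 0 1 : ℤ) : ℂ)) / (((γ 1 0 : ℤ) : ℂ) * τ + ((γ 1 1 : ℤ) : ℂ))) •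
          B.map ((↑) : ℤ → ℂ))) 0 =
      (Λ * (((γ 1 0 : ℤ) : ℂ) * τ + ((γ 1 1 : ℤ) : ℂ)) ^ 2 *
          cexp (π * I * thetaTransformPhase (symplEmbed B γ) a b)) •
        fderiv ℂ (riemannThetaChar a b (τ • B.map ((↑) : ℤ → ℂ))) 0 := by
  set M := symplEmbed B γ with hMdef
  set Bc : Matrix (Fin 2) (Fin 2) ℂ := B.map ((↑) : ℤ → ℂ) with hBc
  set w : ℂ := ((γ 1 0 : ℤ) : ℂ) * τ + ((γ 1 1 : ℤ) : ℂ) with hw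
  set gτ : ℂ := (((γ 0 0 : ℤ) : ℂ) * τ + ((γ 0 1 : ℤ) : ℂ)) / w with hgτ
  have hw0 : w ≠ 0 := denom_ne_zero γ hτ
  have hM : M ∈ Matrix.symplecticGroup (Fin 2) ℤ := symplEmbed_mem hB hγ
  -- both period matrices lie in `𝔥₂`; differentiability of the two theta functions
  have hZ : τ • Bc ∈ siegelUpperHalfSpace 2 := smul_mem_siegelUpperHalfSpace hB hpos hτ
  have hZ' : gτ • Bc ∈ siegelUpperHalfSpace 2 := by
    have h := moeb_intCast_mem hM hZ
    rwa [moeb_symplEmbed hB hγ hw0] at h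
  obtain ⟨c₁, hc₁, hY₁⟩ := exists_pos_mul_sum_sq_le_of_posDef_im _ hZ.2
  obtain ⟨c₂, hc₂, hY₂⟩ := exists_pos_mul_sum_sq_le_of_posDef_im _ hZ'.2
  have hZs : ∀ i j, (τ • Bc) i j = (τ • Bc) j i := fun i j => (hZ.1.apply i j).symm
  have hZ's : ∀ i j, (gτ • Bc) i j = (gτ • Bc) j i := fun i j => (hZ'.1.apply i j).symm
  have hd₁ : DifferentiableAt ℂ (riemannThetaChar a b (τ • Bc)) 0 :=
    (differentiable_riemannThetaChar _ hZs hc₁ hY₁ a b) 0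
  have hd₂ : DifferentiableAt ℂ
      (riemannThetaChar (thetaCharFst M a b) (thetaCharSnd M a b) (gτ • Bc)) 0 :=
    (differentiable_riemannThetaChar _ hZ's hc₂ hY₂ (thetaCharFst M a b) (thetaCharSnd M a b)) 0
  have h := fderiv_eq_smul_of_transform_law hd₁ hd₂ hw0
    ((denom (M.map ((↑) : ℤ → ℂ)) (τ • Bc))⁻¹ * (M.map ((↑) : ℤ → ℂ)).toBlocks₂₁)
    (K := Λ * w * cexp (π * I * thetaTransformPhase M a b)) (fun v => by rw [hΛ τ hτ v])
  rw [h]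
  congr 1
  ring

end Literature.NumberTheory.ModularForms.BinaryTheta

end
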